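import Summits.Parity.BatemanHorn.Theorems.SoloInformedHooleyShiftBlocks

/-!
# Second-order Abel summation for finite Fourier kernels on `ℤ/e`

Informed soloist `solo-Parity-informed` (session 143), conjunct `BatemanHorn`, the `d ≥ 3` rung BELOW the parity
wall (Erdős's divisor problem along an irreducible cubic); generic tool file for the TRAPEZOID programme
(`SoloInformedTrapezoidForm`), which removes the shifts from the typed hypothesis `HooleyShiftUniform` of
`SoloInformedHooleyShiftHypothesis` by averaging the cut-off in `n` and summing by parts TWICE in `n`.

Everything here is elementary and self-contained:

* `prev Φ`, `bdiff Φ` — the backward difference `∇Φ(m) = Φ(m) − Φ(m−1)` of a sequence on `ℕ` extended by `0` to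
  the left (`Φ(−1) = 0`), its additivity and the first and second LEIBNIZ RULES
  `∇(fu) = ∇f·u + f(·−1)·∇u`, `∇²(fu) = ∇²f·u + 2∇f(·−1)·∇u + f(·−2)·∇²u`;
* `kernelSum N Φ w = ∑_{m≤N} Φ(m) w^m` — the ABEL IDENTITIES
  `K(Φ)·(1 − w) = K(∇Φ) − Φ(N)w^{N+1}` and, for `Φ(N) = Φ(N−1) = 0`, `K(Φ)·(1 − w)² = K(∇²Φ)`;
* the resulting bounds `|K(Φ)| ≤ ∑|Φ|`, `≤ V₁(Φ)/|1 − w|`, `≤ V₂(Φ)/|1 − w|²` (`V_r = ∑_{m≤N} |∇^r Φ(m)|`), and at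
  `w = e(−h/e)`, `0 < 2|h| ≤ e`, where `|1 − w| ≥ 4|h|/e` (Jordan): `|K(Φ)| ≤ V₁·e/(4|h|)` and
  `|K(Φ)| ≤ V₂·(e/(4|h|))²` — the second is the `1/h²` decay that localises the frequency;
* summed Leibniz bounds `V₁(fu) ≤ U₀V₁(f) + U₁∑|f|`, `V₂(fu) ≤ U₀V₂(f) + 2U₁V₁(f) + U₂∑|f|` under
  `|u| ≤ U₀`, `|∇u| ≤ U₁` (`m ≥ 1`), `|∇²u| ≤ U₂` (`m ≥ 2`);
* the phase factor `u(m) = ξ^m − 1`, `|ξ| = 1`: `|u(m)| ≤ m|ξ − 1|`, `|∇u| = |ξ − 1|`, `|∇²u| = |ξ − 1|²` (`m ≥ 2`),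
  the chord bound `|e(k/q) − 1| ≤ 2π|k|/q`, and the change of modulus
  `e(−hm/(e+1)) = e(−hm/e)·e(hm/(e(e+1)))` (so the `e`-variation of the phase is such a factor with
  `|ξ − 1| ≤ 2π|h|/(e(e+1))`).

Nothing here moves a wall row; verdict NO PATH unchanged.
-/

namespace Summit.Parity.BatemanHorn.Theorems

open Finset

/-! ### Backward differences of sequences extended by zero -/

section Diff

variable {α : Type*} [AddCommGroup α]

/-- `prev Φ m = Φ(m − 1)` with the convention `Φ(−1) = 0`. [folklore] -/
def prev (Φ : ℕ → α) : ℕ → α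
  | 0 => 0
  | m + 1 => Φ m

/-- `Φ(−1) = 0`. [folklore] -/
@[simp] theorem prev_zero (Φ : ℕ → α) : prev Φ 0 = 0 := rfl

/-- `prev Φ (m+1) = Φ m`. [folklore] -/
@[simp] theorem prev_succ (Φ : ℕ → α) (m : ℕ) : prev Φ (m + 1) = Φ m := rfl

/-- The backward difference `∇Φ(m) = Φ(m) − Φ(m − 1)` (`Φ(−1) = 0`). [folklore] -/
def bdiff (Φ : ℕ → α) (m : ℕ) : α := Φ m - prev Φ m

/-- `∇Φ(0) = Φ(0)`. [folklore] -/
theorem bdiff_zero (Φ : ℕ → α) : bdiff Φ 0 = Φ 0 := by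
  simp [bdiff]

/-- `∇Φ(m+1) = Φ(m+1) − Φ(m)`. [folklore] -/
theorem bdiff_succ (Φ : ℕ → α) (m : ℕ) : bdiff Φ (m + 1) = Φ (m + 1) - Φ m := by
  simp [bdiff]

/-- `∇` commutes with the shift: `(∇Φ)(m − 1) = ∇(Φ(· − 1))(m)`. [folklore] -/
theorem prev_bdiff (Φ : ℕ → α) (m : ℕ) : prev (bdiff Φ) m = bdiff (prev Φ) m := by
  cases m with
  | zero => simp [bdiff]
  | succ k => simp only [prev_succ, bdiff]

/-- The shift is additive. [folklore] -/
theorem prev_add (a b : ℕ → α) (m : ℕ) : prev (fun k => a k + b k) m = prev a m + prev b m := by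
  cases m with
  | zero => simp
  | succ k => simp

/-- `∇` is additive. [folklore] -/
theorem bdiff_add (a b : ℕ → α) (m : ℕ) : bdiff (fun k => a k + b k) m = bdiff a m + bdiff b m := by
  simp only [bdiff, prev_add]
  abel

/-- `Φ(m − 2) = 0` for `m ≤ 1`. [folklore] -/
theorem prev_prev_eq_zero (Φ : ℕ → α) {m : ℕ} (hm : m ≤ 1) : prev (prev Φ) m = 0 := by
  interval_cases m <;> rfl

/-- If `Φ(N) = Φ(N−1) = 0` then `∇Φ(N) = 0`. [folklore] -/
theorem bdiff_eq_zero_of_top (Φ : ℕ → α) {N : ℕ} (hN : Φ N = 0) (hN' : Φ (N - 1) = 0) : bdiff Φ N = 0 := by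
  cases N with
  | zero => rw [bdiff_zero, hN]
  | succ k =>
      rw [Nat.add_sub_cancel] at hN'
      rw [bdiff_succ, hN, hN', sub_zero]

end Diff

/-! ### Leibniz rules -/

/-- The shift is multiplicative. [folklore] -/
theorem prev_mul (f u : ℕ → ℂ) (m : ℕ) : prev (fun k => f k * u k) m = prev f m * prev u m := by
  cases m with
  | zero => simp
  | succ k => simp

/-- **First Leibniz rule** `∇(fu)(m) = ∇f(m)·u(m) + f(m−1)·∇u(m)`. [folklore] -/
theorem bdiff_mul (f u : ℕ → ℂ) (m : ℕ) :
    bdiff (fun k => f k * u k) m = bdiff f m * u m + prev f m * bdiff u m := by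
  cases m with
  | zero => simp [bdiff]
  | succ k =>
      simp only [bdiff, prev_succ]
      ring

/-- **Second Leibniz rule** `∇²(fu)(m) = ∇²f(m)·u(m) + 2·∇f(m−1)·∇u(m) + f(m−2)·∇²u(m)`. [folklore] -/
theorem bdiff_bdiff_mul (f u : ℕ → ℂ) (m : ℕ) :
    bdiff (bdiff (fun k => f k * u k)) m
      = bdiff (bdiff f) m * u m + 2 * (bdiff (prev f) m * bdiff u m) + prev (prev f) m * bdiff (bdiff u) m := by
  have h1 : bdiff (fun k => f k * u k) = fun k => bdiff f k * u k + prev f k * bdiff u k :=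
    funext (bdiff_mul f u)
  rw [h1, bdiff_add, bdiff_mul, bdiff_mul, prev_bdiff]
  ring

/-! ### Sums of norms of shifted sequences -/

/-- `∑_{m≤N} |Φ(m−1)| ≤ ∑_{m≤N} |Φ(m)|`. [folklore] -/
theorem sum_norm_prev_le (N : ℕ) (Φ : ℕ → ℂ) :
    ∑ m ∈ range (N + 1), ‖prev Φ m‖ ≤ ∑ m ∈ range (N + 1), ‖Φ m‖ := by
  rw [sum_range_succ' (fun m => ‖prev Φ m‖), sum_range_succ]
  simp only [prev_succ, prev_zero, norm_zero, add_zero]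
  exact le_add_of_nonneg_right (norm_nonneg _)

/-- `∑_{m≤N} |∇Φ(m−1)| ≤ ∑_{m≤N} |∇Φ(m)|` in the form `∑ |∇(Φ(·−1))| ≤ ∑ |∇Φ|`. [folklore] -/
theorem sum_norm_bdiff_prev_le (N : ℕ) (Φ : ℕ → ℂ) :
    ∑ m ∈ range (N + 1), ‖bdiff (prev Φ) m‖ ≤ ∑ m ∈ range (N + 1), ‖bdiff Φ m‖ := by
  have h : ∀ m, bdiff (prev Φ) m = prev (bdiff Φ) m := fun m => (prev_bdiff Φ m).symm
  simp only [h]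
  exact sum_norm_prev_le N (bdiff Φ)

/-! ### Summed Leibniz bounds -/

/-- **`V₁(fu) ≤ U₀·V₁(f) + U₁·∑|f|`** when `|u| ≤ U₀` on `[0, N]` and `|∇u(m)| ≤ U₁` for `1 ≤ m ≤ N`. [folklore] -/
theorem sum_norm_bdiff_mul_le (N : ℕ) (f u : ℕ → ℂ) {U₀ U₁ : ℝ} (hU₁0 : 0 ≤ U₁)
    (hU₀ : ∀ m ∈ range (N + 1), ‖u m‖ ≤ U₀) (hU₁ : ∀ m ∈ range (N + 1), 1 ≤ m → ‖bdiff u m‖ ≤ U₁) :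
    ∑ m ∈ range (N + 1), ‖bdiff (fun k => f k * u k) m‖
      ≤ U₀ * ∑ m ∈ range (N + 1), ‖bdiff f m‖ + U₁ * ∑ m ∈ range (N + 1), ‖f m‖ := by
  have hterm : ∀ m ∈ range (N + 1),
      ‖bdiff (fun k => f k * u k) m‖ ≤ U₀ * ‖bdiff f m‖ + U₁ * ‖prev f m‖ := by
    intro m hm
    rw [bdiff_mul]
    refine (norm_add_le _ _).trans (add_le_add ?_ ?_)
    · rw [norm_mul, mul_comm]
      exact mul_le_mul_of_nonneg_right (hU₀ m hm) (norm_nonneg _)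
    · rw [norm_mul, mul_comm]
      rcases Nat.eq_zero_or_pos m with rfl | hm1
      · simp
      · exact mul_le_mul_of_nonneg_right (hU₁ m hm hm1) (norm_nonneg _)
  refine (sum_le_sum hterm).trans ?_
  rw [sum_add_distrib, ← mul_sum, ← mul_sum]
  exact add_le_add le_rfl (mul_le_mul_of_nonneg_left (sum_norm_prev_le N f) hU₁0)

/-- **`V₂(fu) ≤ U₀·V₂(f) + 2U₁·V₁(f) + U₂·∑|f|`** when `|u| ≤ U₀` on `[0, N]`, `|∇u(m)| ≤ U₁` for `1 ≤ m ≤ N` and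
`|∇²u(m)| ≤ U₂` for `2 ≤ m ≤ N`. [folklore] -/
theorem sum_norm_bdiff_bdiff_mul_le (N : ℕ) (f u : ℕ → ℂ) {U₀ U₁ U₂ : ℝ} (hU₁0 : 0 ≤ U₁) (hU₂0 : 0 ≤ U₂)
    (hU₀ : ∀ m ∈ range (N + 1), ‖u m‖ ≤ U₀) (hU₁ : ∀ m ∈ range (N + 1), 1 ≤ m → ‖bdiff u m‖ ≤ U₁)
    (hU₂ : ∀ m ∈ range (N + 1), 2 ≤ m → ‖bdiff (bdiff u) m‖ ≤ U₂) :
    ∑ m ∈ range (N + 1), ‖bdiff (bdiff (fun k => f k * u k)) m‖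
      ≤ U₀ * ∑ m ∈ range (N + 1), ‖bdiff (bdiff f) m‖ + 2 * U₁ * ∑ m ∈ range (N + 1), ‖bdiff f m‖
        + U₂ * ∑ m ∈ range (N + 1), ‖f m‖ := by
  have hterm : ∀ m ∈ range (N + 1), ‖bdiff (bdiff (fun k => f k * u k)) m‖
      ≤ U₀ * ‖bdiff (bdiff f) m‖ + 2 * U₁ * ‖bdiff (prev f) m‖ + U₂ * ‖prev (prev f) m‖ := by
    intro m hm
    rw [bdiff_bdiff_mul]
    refine (norm_add₃_le).trans (add_le_add (add_le_add ?_ ?_) ?_)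
    · rw [norm_mul, mul_comm]
      exact mul_le_mul_of_nonneg_right (hU₀ m hm) (norm_nonneg _)
    · rw [norm_mul, RCLike.norm_ofNat, norm_mul, mul_assoc, mul_comm ‖bdiff (prev f) m‖]
      refine mul_le_mul_of_nonneg_left ?_ (by norm_num)
      rcases Nat.eq_zero_or_pos m with rfl | hm1
      · simp [bdiff]
      · exact mul_le_mul_of_nonneg_right (hU₁ m hm hm1) (norm_nonneg _)
    · rw [norm_mul, mul_comm]
      rcases le_or_gt m 1 with hm1 | hm2
      · rw [prev_prev_eq_zero f hm1, norm_zero, mul_zero, mul_zero]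
      · exact mul_le_mul_of_nonneg_right (hU₂ m hm hm2) (norm_nonneg _)
  refine (sum_le_sum hterm).trans ?_
  rw [sum_add_distrib, sum_add_distrib, ← mul_sum, ← mul_sum, ← mul_sum]
  refine add_le_add (add_le_add le_rfl ?_) ?_
  · exact mul_le_mul_of_nonneg_left (sum_norm_bdiff_prev_le N f) (by positivity)
  · exact mul_le_mul_of_nonneg_left ((sum_norm_prev_le N (prev f)).trans (sum_norm_prev_le N f)) hU₂0

/-! ### The kernel sum and the Abel identities -/

/-- `K_N(Φ; w) = ∑_{m ≤ N} Φ(m)·w^m`. [folklore] -/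
noncomputable def kernelSum (N : ℕ) (Φ : ℕ → ℂ) (w : ℂ) : ℂ :=
  ∑ m ∈ range (N + 1), Φ m * w ^ m

/-- `K_0(Φ; w) = Φ(0)`. [folklore] -/
theorem kernelSum_zero_left (Φ : ℕ → ℂ) (w : ℂ) : kernelSum 0 Φ w = Φ 0 := by
  simp [kernelSum]

/-- `K_{N+1} = K_N + Φ(N+1)w^{N+1}`. [folklore] -/
theorem kernelSum_succ (N : ℕ) (Φ : ℕ → ℂ) (w : ℂ) :
    kernelSum (N + 1) Φ w = kernelSum N Φ w + Φ (N + 1) * w ^ (N + 1) := by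
  unfold kernelSum
  rw [sum_range_succ]

/-- The kernel sum over `[1, N]` when `Φ(0) = 0`. [folklore] -/
theorem kernelSum_eq_sum_Icc (N : ℕ) {Φ : ℕ → ℂ} (h0 : Φ 0 = 0) (w : ℂ) :
    kernelSum N Φ w = ∑ m ∈ Icc 1 N, Φ m * w ^ m := by
  unfold kernelSum
  rw [range_eq_Ico, sum_eq_sum_Ico_succ_bot (Nat.succ_pos N), h0, zero_mul, zero_add]
  rfl

/-- **ABEL IDENTITY** `K_N(Φ; w)·(1 − w) = K_N(∇Φ; w) − Φ(N)·w^{N+1}`. [folklore] -/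
theorem kernelSum_mul_one_sub (N : ℕ) (Φ : ℕ → ℂ) (w : ℂ) :
    kernelSum N Φ w * (1 - w) = kernelSum N (bdiff Φ) w - Φ N * w ^ (N + 1) := by
  induction N with
  | zero =>
      rw [kernelSum_zero_left, kernelSum_zero_left, bdiff_zero]
      ring
  | succ k ih =>
      rw [kernelSum_succ, kernelSum_succ, add_mul, ih, bdiff_succ, pow_succ, pow_succ]
      ring

/-- With a vanishing top value: `K_N(Φ; w)·(1 − w) = K_N(∇Φ; w)`. [folklore] -/
theorem kernelSum_mul_one_sub_of_top (N : ℕ) {Φ : ℕ → ℂ} (hN : Φ N = 0) (w : ℂ) :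
    kernelSum N Φ w * (1 - w) = kernelSum N (bdiff Φ) w := by
  rw [kernelSum_mul_one_sub, hN, zero_mul, sub_zero]

/-- **SECOND-ORDER ABEL IDENTITY**: if `Φ(N) = Φ(N−1) = 0` then `K_N(Φ; w)·(1 − w)² = K_N(∇²Φ; w)`. [folklore] -/
theorem kernelSum_mul_one_sub_sq (N : ℕ) {Φ : ℕ → ℂ} (hN : Φ N = 0) (hN' : Φ (N - 1) = 0) (w : ℂ) :
    kernelSum N Φ w * (1 - w) ^ 2 = kernelSum N (bdiff (bdiff Φ)) w := by
  rw [sq, ← mul_assoc, kernelSum_mul_one_sub_of_top N hN,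
    kernelSum_mul_one_sub_of_top N (bdiff_eq_zero_of_top Φ hN hN')]

/-! ### Norm bounds -/

/-- The trivial bound `|K_N(Φ; w)| ≤ ∑_{m≤N} |Φ(m)|` for `|w| ≤ 1`. [folklore] -/
theorem norm_kernelSum_le (N : ℕ) (Φ : ℕ → ℂ) {w : ℂ} (hw : ‖w‖ ≤ 1) :
    ‖kernelSum N Φ w‖ ≤ ∑ m ∈ range (N + 1), ‖Φ m‖ := by
  unfold kernelSum
  refine (norm_sum_le _ _).trans (sum_le_sum fun m _ => ?_)
  rw [norm_mul, norm_pow]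
  exact mul_le_of_le_one_right (norm_nonneg _) (pow_le_one₀ (norm_nonneg _) hw)

/-- **First-order bound** `|K_N(Φ; w)| ≤ V₁(Φ)/|1 − w|` (`Φ(N) = 0`, `|w| ≤ 1`, `w ≠ 1`). [folklore] -/
theorem norm_kernelSum_le_first (N : ℕ) {Φ : ℕ → ℂ} (hN : Φ N = 0) {w : ℂ} (hw : ‖w‖ ≤ 1) (hw1 : w ≠ 1) :
    ‖kernelSum N Φ w‖ ≤ (∑ m ∈ range (N + 1), ‖bdiff Φ m‖) / ‖1 - w‖ := by
  have hpos : 0 < ‖1 - w‖ := norm_pos_iff.mpr (sub_ne_zero.mpr (Ne.symm hw1))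
  rw [le_div_iff₀ hpos, ← norm_mul, kernelSum_mul_one_sub_of_top N hN]
  exact norm_kernelSum_le N _ hw

/-- **Second-order bound** `|K_N(Φ; w)| ≤ V₂(Φ)/|1 − w|²` (`Φ(N) = Φ(N−1) = 0`, `|w| ≤ 1`, `w ≠ 1`). [folklore] -/
theorem norm_kernelSum_le_second (N : ℕ) {Φ : ℕ → ℂ} (hN : Φ N = 0) (hN' : Φ (N - 1) = 0) {w : ℂ}
    (hw : ‖w‖ ≤ 1) (hw1 : w ≠ 1) :
    ‖kernelSum N Φ w‖ ≤ (∑ m ∈ range (N + 1), ‖bdiff (bdiff Φ) m‖) / ‖1 - w‖ ^ 2 := by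
  have hpos : 0 < ‖1 - w‖ := norm_pos_iff.mpr (sub_ne_zero.mpr (Ne.symm hw1))
  rw [le_div_iff₀ (pow_pos hpos 2), ← norm_pow, ← norm_mul, kernelSum_mul_one_sub_sq N hN hN']
  exact norm_kernelSum_le N _ hw

/-! ### At `w = e(−h/e)` -/

/-- `K_N(Φ; e(−h/e)) = ∑_{m≤N} Φ(m)·e(−hm/e)`. [folklore] -/
theorem kernelSum_eAdd (N : ℕ) (Φ : ℕ → ℂ) (e : ℕ) (h : ℤ) :
    kernelSum N Φ (eAdd e (-h)) = ∑ m ∈ range (N + 1), Φ m * eAdd e (-(h * m)) := by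
  unfold kernelSum
  exact sum_congr rfl fun m _ => by rw [eAdd_neg_mul_nat]

/-- **Jordan**: `4|h|/e ≤ |1 − e(−h/e)|` for `h ≠ 0`, `2|h| ≤ e`. [folklore] -/
theorem four_mul_abs_div_le_norm_one_sub_eAdd {e : ℕ} {h : ℤ} (h0 : h ≠ 0) (h2 : 2 * |h| ≤ (e : ℤ)) :
    4 * |(h : ℝ)| / e ≤ ‖1 - eAdd e (-h)‖ := by
  have hne := eAdd_neg_ne_one_of_two_mul_abs_le h0 h2
  have h1 := norm_inv_eAdd_sub_one_le h0 h2
  have hpos : 0 < ‖eAdd e (-h) - 1‖ := norm_pos_iff.mpr (sub_ne_zero.mpr hne)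
  have habs : (0 : ℝ) < |(h : ℝ)| := abs_pos.mpr (by exact_mod_cast h0)
  have habs1 : (1 : ℤ) ≤ |h| := Int.one_le_abs h0
  have he2 : (2 : ℤ) ≤ e := by omega
  have he : (0 : ℝ) < e := by exact_mod_cast (show (0 : ℤ) < e by omega)
  rw [norm_div, norm_one, div_le_div_iff₀ hpos (by positivity), one_mul] at h1
  rw [norm_sub_rev, div_le_iff₀ he]
  linarith

/-- **`|K_N(Φ; e(−h/e))| ≤ V₁(Φ)·e/(4|h|)`** for `Φ(N) = 0`, `h ≠ 0`, `2|h| ≤ e`. [this work] -/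
theorem norm_kernelSum_eAdd_le_first (N : ℕ) {Φ : ℕ → ℂ} (hN : Φ N = 0) {e : ℕ} {h : ℤ} (h0 : h ≠ 0)
    (h2 : 2 * |h| ≤ (e : ℤ)) :
    ‖kernelSum N Φ (eAdd e (-h))‖ ≤ (∑ m ∈ range (N + 1), ‖bdiff Φ m‖) * ((e : ℝ) / (4 * |(h : ℝ)|)) := by
  have hne := eAdd_neg_ne_one_of_two_mul_abs_le h0 h2
  have hj := four_mul_abs_div_le_norm_one_sub_eAdd h0 h2
  have habs : (0 : ℝ) < |(h : ℝ)| := abs_pos.mpr (by exact_mod_cast h0)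
  have habs1 : (1 : ℤ) ≤ |h| := Int.one_le_abs h0
  have he : (0 : ℝ) < e := by exact_mod_cast (show (0 : ℤ) < e by omega)
  have hlow : 0 < 4 * |(h : ℝ)| / e := by positivity
  refine (norm_kernelSum_le_first N hN (le_of_eq (norm_eAdd _ _)) hne).trans ?_
  rw [div_eq_mul_one_div]
  refine mul_le_mul_of_nonneg_left ?_ (sum_nonneg fun _ _ => norm_nonneg _)
  calc 1 / ‖1 - eAdd e (-h)‖ ≤ 1 / (4 * |(h : ℝ)| / e) := one_div_le_one_div_of_le hlow hj
    _ = (e : ℝ) / (4 * |(h : ℝ)|) := by rw [one_div_div]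

/-- **`|K_N(Φ; e(−h/e))| ≤ V₂(Φ)·(e/(4|h|))²`** for `Φ(N) = Φ(N−1) = 0`, `h ≠ 0`, `2|h| ≤ e`: the `1/h²` decay.
[this work] -/
theorem norm_kernelSum_eAdd_le_second (N : ℕ) {Φ : ℕ → ℂ} (hN : Φ N = 0) (hN' : Φ (N - 1) = 0) {e : ℕ}
    {h : ℤ} (h0 : h ≠ 0) (h2 : 2 * |h| ≤ (e : ℤ)) :
    ‖kernelSum N Φ (eAdd e (-h))‖
      ≤ (∑ m ∈ range (N + 1), ‖bdiff (bdiff Φ) m‖) * ((e : ℝ) / (4 * |(h : ℝ)|)) ^ 2 := by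
  have hne := eAdd_neg_ne_one_of_two_mul_abs_le h0 h2
  have hj := four_mul_abs_div_le_norm_one_sub_eAdd h0 h2
  have habs : (0 : ℝ) < |(h : ℝ)| := abs_pos.mpr (by exact_mod_cast h0)
  have habs1 : (1 : ℤ) ≤ |h| := Int.one_le_abs h0
  have he : (0 : ℝ) < e := by exact_mod_cast (show (0 : ℤ) < e by omega)
  have hlow : 0 < 4 * |(h : ℝ)| / e := by positivity
  refine (norm_kernelSum_le_second N hN hN' (le_of_eq (norm_eAdd _ _)) hne).trans ?_
  rw [div_eq_mul_one_div]
  refine mul_le_mul_of_nonneg_left ?_ (sum_nonneg fun _ _ => norm_nonneg _)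
  have h1 : (4 * |(h : ℝ)| / e) ^ 2 ≤ ‖1 - eAdd e (-h)‖ ^ 2 := pow_le_pow_left₀ hlow.le hj 2
  calc 1 / ‖1 - eAdd e (-h)‖ ^ 2 ≤ 1 / (4 * |(h : ℝ)| / e) ^ 2 := one_div_le_one_div_of_le (by positivity) h1
    _ = ((e : ℝ) / (4 * |(h : ℝ)|)) ^ 2 := by rw [one_div, ← inv_pow, inv_div]

/-! ### The phase factor `ξ^m − 1` -/

/-- `|ξ^m − 1| ≤ m·|ξ − 1|` for `|ξ| = 1`. [folklore] -/
theorem norm_pow_sub_one_le {ξ : ℂ} (hξ : ‖ξ‖ = 1) (m : ℕ) : ‖ξ ^ m - 1‖ ≤ m * ‖ξ - 1‖ := by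
  induction m with
  | zero => simp
  | succ k ih =>
      have hsplit : ξ ^ (k + 1) - 1 = ξ * (ξ ^ k - 1) + (ξ - 1) := by ring
      rw [hsplit]
      refine (norm_add_le _ _).trans ?_
      rw [norm_mul, hξ, one_mul]
      push_cast
      linarith

/-- `∇(ξ^· − 1)(m+1) = ξ^m(ξ − 1)`, so `|∇u(m)| = |ξ − 1|` for `m ≥ 1`. [folklore] -/
theorem norm_bdiff_pow_sub_one {ξ : ℂ} (hξ : ‖ξ‖ = 1) {m : ℕ} (hm : 1 ≤ m) :
    ‖bdiff (fun k => ξ ^ k - 1) m‖ = ‖ξ - 1‖ := by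
  obtain ⟨k, rfl⟩ := Nat.exists_eq_add_of_le' hm
  rw [bdiff_succ, show ξ ^ (k + 1) - 1 - (ξ ^ k - 1) = ξ ^ k * (ξ - 1) by ring, norm_mul, norm_pow, hξ,
    one_pow, one_mul]

/-- `∇²(ξ^· − 1)(m+2) = ξ^m(ξ − 1)²`, so `|∇²u(m)| = |ξ − 1|²` for `m ≥ 2`. [folklore] -/
theorem norm_bdiff_bdiff_pow_sub_one {ξ : ℂ} (hξ : ‖ξ‖ = 1) {m : ℕ} (hm : 2 ≤ m) :
    ‖bdiff (bdiff (fun k => ξ ^ k - 1)) m‖ = ‖ξ - 1‖ ^ 2 := by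
  obtain ⟨k, rfl⟩ := Nat.exists_eq_add_of_le' hm
  have h1 : bdiff (bdiff (fun k => ξ ^ k - 1)) (k + 2) = ξ ^ k * (ξ - 1) ^ 2 := by
    rw [show k + 2 = (k + 1) + 1 from rfl, bdiff_succ, bdiff_succ, bdiff_succ]
    ring
  rw [h1, norm_mul, norm_pow, hξ, one_pow, one_mul, norm_pow]

/-- **Chord bound** `|e(k/q) − 1| ≤ 2π|k|/q`. [folklore] -/
theorem norm_eAdd_sub_one_le {q : ℕ} (hq : q ≠ 0) (k : ℤ) :
    ‖eAdd q k - 1‖ ≤ 2 * Real.pi * |(k : ℝ)| / q := by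
  have hq0 : (0 : ℝ) < q := by exact_mod_cast Nat.pos_of_ne_zero hq
  have e1 : eAdd q k = Complex.exp (Complex.I * ((2 * Real.pi * k / q : ℝ) : ℂ)) := by
    rw [eAdd]
    congr 1
    push_cast
    ring
  rw [e1]
  refine (Real.norm_exp_I_mul_ofReal_sub_one_le).trans (le_of_eq ?_)
  rw [Real.norm_eq_abs, abs_div, abs_mul, abs_mul, abs_of_pos (by norm_num : (0 : ℝ) < 2),
    abs_of_pos Real.pi_pos, abs_of_pos hq0]

/-- **Change of modulus in the phase**: `e(−hm/(e+1)) = e(−hm/e)·e(hm/(e(e+1)))` — the `e`-variation of the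
phase `m ↦ e(−hm/e)` is the factor `ξ^m`, `ξ = e(h/(e(e+1)))`, `|ξ − 1| ≤ 2π|h|/(e(e+1))`. [folklore] -/
theorem eAdd_succ_neg_mul_eq (e : ℕ) (he : e ≠ 0) (h : ℤ) (m : ℕ) :
    eAdd (e + 1) (-(h * m)) = eAdd e (-(h * m)) * eAdd (e * (e + 1)) h ^ m := by
  rw [← eAdd_nat_mul, eAdd, eAdd, eAdd, ← Complex.exp_add]
  congr 1
  have he0 : (e : ℂ) ≠ 0 := by exact_mod_cast he
  have he1 : ((e + 1 : ℕ) : ℂ) ≠ 0 := by exact_mod_cast Nat.succ_ne_zero e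
  have he2 : ((e * (e + 1) : ℕ) : ℂ) ≠ 0 := by exact_mod_cast (Nat.mul_ne_zero he (Nat.succ_ne_zero e))
  field_simp
  push_cast
  ring

/-- The phase-variation factor has `|ξ − 1| ≤ 2π|h|/(e(e+1))`. [folklore] -/
theorem norm_eAdd_mul_succ_sub_one_le {e : ℕ} (he : e ≠ 0) (h : ℤ) :
    ‖eAdd (e * (e + 1)) h - 1‖ ≤ 2 * Real.pi * |(h : ℝ)| / ((e : ℝ) * ((e : ℝ) + 1)) := by
  have := norm_eAdd_sub_one_le (Nat.mul_ne_zero he (Nat.succ_ne_zero e)) h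
  push_cast at this
  exact this

end Summit.Parity.BatemanHorn.Theorems
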